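import Summits.Ventures.PercRepro.RankLevelSetLevelSixHeavyCellSq27DI
import Summits.Ventures.PercRepro.RankLevelSetLevelSixCapGlue25
import Summits.Ventures.PercRepro.TriangleCapEightI
import Summits.Ventures.PercRepro.S1TrianglePlusSharp
import Summits.Ventures.PercRepro.S1SeriesLever14
import Summits.Ventures.PercRepro.RankLevelSetLevelSixArithHeavySq24DNA
import Summits.Ventures.PercRepro.RankLevelSetLevelSixArithHeavySq24DNB
import Summits.Ventures.PercRepro.RankLevelSetLevelSixArithHeavySq24DNC
import Summits.Ventures.PercRepro.RankLevelSetLevelSixArithHeavySq24DND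

/-!
# PercRepro — THE 24 ROW, THE CELLS `(p ≥ 24, 13 ≤ d ≤ 20)`, EVERY CORE (p8 g10, S3)

`proofs/SUBCLAIM-S3-p8.md` §3x. The corrected cell `sq27di` at rank `p ≥ 24` with the per-corank parameters of ArithHeavySq24DNA … D
(nullity-only caps: p3's `cq3` table, `avgChain14 d`, `avgChain5c d`; `Kd = 1000`), ratios `0.879 / 0.907 / 0.693 / 0.684 / 0.635 / 0.668 / 0.719 / 0.784`. Axioms: standard.
-/

open scoped Matroid

namespace PercRepro

namespace ThmN

open Set

variable {α : Type}

/-- **The `e`-free core at rank `p ≥ 24`, corank `13 ≤ d ≤ 20`, EVERY core** (the cell `sq27di` with the nullity-only caps and the parts Sq24DNA … D). -/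
theorem c025_core_six_basis_sq24_dn (M : Matroid α) [M.Finite] (p d : ℕ) (hp : 24 ≤ p) (hd13 : 13 ≤ d) (hd20 : d ≤ 20)
    (hR : M.eRank = (p : ℕ∞)) (hn : M.E.ncard = p + d)
    (hfree : ∀ e ∈ M.E, ∃ A ⊆ M.E \ {e}, e ∉ M.closure A ∧ e ∉ M.closure ((M.E \ {e}) \ A)) :
    RLS M p 6 := by
  have hd : M.E.encard = M.eRank + d := by
    rw [hR, ← M.ground_finite.cast_ncard_eq, hn]
    push_cast
    ring
  have hΦ : phiK p 6 ≤ (2 : ℚ) ^ (p + 6) / (((p + 6).choose 6 : ℕ) : ℚ) := phiK_le_two_pow_div_six p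
  rw [RLS_iff]
  interval_cases d
  · exact c025_core_six_heavy_cell_sq27di M p 13 10 1 1 22 18 0 19800 1000 19 3893 372 34
      ((p + 6).choose 6) (Nat.choose_pos (by omega)) (phiK p 6) hΦ (by norm_num) (by omega)
      (by norm_num) (by norm_num) (by norm_num) (by norm_num) (by norm_num)
      (by norm_num [cnull]) (by norm_num [cnull]) (Or.inl (by norm_num)) (Or.inr (Or.inl ⟨by norm_num, by norm_num⟩)) (Or.inl (by norm_num)) (by norm_num) (by norm_num) (by norm_num)
      ((TriangleCap.core_ncard_triangles_le_cq3 M hfree hd).trans (by decide))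
      ((ncard_fourCircuits_le_avgChain14 13 M hfree hd).trans (by decide))
      ((S1.ncard_fiveCircuits_le_avgChain5c 13 M hfree hd).trans (by decide))
      (Or.inl (tail_six_heavy_sq24DN_13 p hp)) hR hn hfree (level_six_poly_heavy_sq24DN_13 p hp)
  · exact c025_core_six_heavy_cell_sq27di M p 14 11 1 1 23 19 0 13787 1000 20 5283 471 40
      ((p + 6).choose 6) (Nat.choose_pos (by omega)) (phiK p 6) hΦ (by norm_num) (by omega)
      (by norm_num) (by norm_num) (by norm_num) (by norm_num) (by norm_num)
      (by norm_num [cnull]) (by norm_num [cnull]) (Or.inl (by norm_num)) (Or.inr (Or.inl ⟨by norm_num, by norm_num⟩)) (Or.inl (by norm_num)) (by norm_num) (by norm_num) (by norm_num)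
      ((TriangleCap.core_ncard_triangles_le_cq3 M hfree hd).trans (by decide))
      ((ncard_fourCircuits_le_avgChain14 14 M hfree hd).trans (by decide))
      ((S1.ncard_fiveCircuits_le_avgChain5c 14 M hfree hd).trans (by decide))
      (Or.inl (tail_six_heavy_sq24DN_14 p hp)) hR hn hfree (level_six_poly_heavy_sq24DN_14 p hp)
  · exact c025_core_six_heavy_cell_sq27di M p 15 11 1 1 25 19 0 9958 1000 21 7044 588 47
      ((p + 6).choose 6) (Nat.choose_pos (by omega)) (phiK p 6) hΦ (by norm_num) (by omega)
      (by norm_num) (by norm_num) (by norm_num) (by norm_num) (by norm_num)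
      (by norm_num [cnull]) (by norm_num [cnull]) (Or.inl (by norm_num)) (Or.inr (Or.inl ⟨by norm_num, by norm_num⟩)) (Or.inl (by norm_num)) (by norm_num) (by norm_num) (by norm_num)
      ((TriangleCap.core_ncard_triangles_le_cq3 M hfree hd).trans (by decide))
      ((ncard_fourCircuits_le_avgChain14 15 M hfree hd).trans (by decide))
      ((S1.ncard_fiveCircuits_le_avgChain5c 15 M hfree hd).trans (by decide))
      (Or.inl (tail_six_heavy_sq24DN_15 p hp)) hR hn hfree (level_six_poly_heavy_sq24DN_15 p hp)
  · exact c025_core_six_heavy_cell_sq27di M p 16 12 1 1 26 19 0 7429 1000 22 9245 726 54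
      ((p + 6).choose 6) (Nat.choose_pos (by omega)) (phiK p 6) hΦ (by norm_num) (by omega)
      (by norm_num) (by norm_num) (by norm_num) (by norm_num) (by norm_num)
      (by norm_num [cnull]) (by norm_num [cnull]) (Or.inl (by norm_num)) (Or.inr (Or.inl ⟨by norm_num, by norm_num⟩)) (Or.inl (by norm_num)) (by norm_num) (by norm_num) (by norm_num)
      ((TriangleCap.core_ncard_triangles_le_cq3 M hfree hd).trans (by decide))
      ((ncard_fourCircuits_le_avgChain14 16 M hfree hd).trans (by decide))
      ((S1.ncard_fiveCircuits_le_avgChain5c 16 M hfree hd).trans (by decide))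
      (Or.inl (tail_six_heavy_sq24DN_16 p hp)) hR hn hfree (level_six_poly_heavy_sq24DN_16 p hp)
  · exact c025_core_six_heavy_cell_sq27di M p 17 12 1 1 28 19 0 5718 1000 23 11964 887 62
      ((p + 6).choose 6) (Nat.choose_pos (by omega)) (phiK p 6) hΦ (by norm_num) (by omega)
      (by norm_num) (by norm_num) (by norm_num) (by norm_num) (by norm_num)
      (by norm_num [cnull]) (by norm_num [cnull]) (Or.inl (by norm_num)) (Or.inr (Or.inl ⟨by norm_num, by norm_num⟩)) (Or.inl (by norm_num)) (by norm_num) (by norm_num) (by norm_num)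
      ((TriangleCap.core_ncard_triangles_le_cq3 M hfree hd).trans (by decide))
      ((ncard_fourCircuits_le_avgChain14 17 M hfree hd).trans (by decide))
      ((S1.ncard_fiveCircuits_le_avgChain5c 17 M hfree hd).trans (by decide))
      (Or.inl (tail_six_heavy_sq24DN_17 p hp)) hR hn hfree (level_six_poly_heavy_sq24DN_17 p hp)
  · exact c025_core_six_heavy_cell_sq27di M p 18 13 1 1 29 19 0 4529 1000 24 15287 1073 71
      ((p + 6).choose 6) (Nat.choose_pos (by omega)) (phiK p 6) hΦ (by norm_num) (by omega)
      (by norm_num) (by norm_num) (by norm_num) (by norm_num) (by norm_num)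
      (by norm_num [cnull]) (by norm_num [cnull]) (Or.inl (by norm_num)) (Or.inr (Or.inl ⟨by norm_num, by norm_num⟩)) (Or.inl (by norm_num)) (by norm_num) (by norm_num) (by norm_num)
      ((TriangleCap.core_ncard_triangles_le_cq3 M hfree hd).trans (by decide))
      ((ncard_fourCircuits_le_avgChain14 18 M hfree hd).trans (by decide))
      ((S1.ncard_fiveCircuits_le_avgChain5c 18 M hfree hd).trans (by decide))
      (Or.inl (tail_six_heavy_sq24DN_18 p hp)) hR hn hfree (level_six_poly_heavy_sq24DN_18 p hp)
  · exact c025_core_six_heavy_cell_sq27di M p 19 13 1 1 31 19 0 3681 1000 25 19309 1287 81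
      ((p + 6).choose 6) (Nat.choose_pos (by omega)) (phiK p 6) hΦ (by norm_num) (by omega)
      (by norm_num) (by norm_num) (by norm_num) (by norm_num) (by norm_num)
      (by norm_num [cnull]) (by norm_num [cnull]) (Or.inl (by norm_num)) (Or.inr (Or.inl ⟨by norm_num, by norm_num⟩)) (Or.inl (by norm_num)) (by norm_num) (by norm_num) (by norm_num)
      ((TriangleCap.core_ncard_triangles_le_cq3 M hfree hd).trans (by decide))
      ((ncard_fourCircuits_le_avgChain14 19 M hfree hd).trans (by decide))
      ((S1.ncard_fiveCircuits_le_avgChain5c 19 M hfree hd).trans (by decide))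
      (Or.inl (tail_six_heavy_sq24DN_19 p hp)) hR hn hfree (level_six_poly_heavy_sq24DN_19 p hp)
  · exact c025_core_six_heavy_cell_sq27di M p 20 14 1 1 32 19 0 3065 1000 26 24136 1532 92
      ((p + 6).choose 6) (Nat.choose_pos (by omega)) (phiK p 6) hΦ (by norm_num) (by omega)
      (by norm_num) (by norm_num) (by norm_num) (by norm_num) (by norm_num)
      (by norm_num [cnull]) (by norm_num [cnull]) (Or.inl (by norm_num)) (Or.inr (Or.inl ⟨by norm_num, by norm_num⟩)) (Or.inl (by norm_num)) (by norm_num) (by norm_num) (by norm_num)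
      ((TriangleCap.core_ncard_triangles_le_cq3 M hfree hd).trans (by decide))
      ((ncard_fourCircuits_le_avgChain14 20 M hfree hd).trans (by decide))
      ((S1.ncard_fiveCircuits_le_avgChain5c 20 M hfree hd).trans (by decide))
      (Or.inl (tail_six_heavy_sq24DN_20 p hp)) hR hn hfree (level_six_poly_heavy_sq24DN_20 p hp)

end ThmN

end PercRepro
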